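import Mathlib
import HarnessLib
import Summits.NavierStokesRegularity.NavierStokesRegularity.Theorems.TypeIQuarterGateScarEnvelopeTypeIForcedTsaiCert

/-!
# ARM B lane E-exact — REAL SEMANTICS of the symbolic objects of `…ForcedTsaiCert` and their algebra
  (definitions `Mono.eval`, `QPoly.eval`, `evalVec`, `gauss`, `WitnessRow.aR`, `WitnessRow.field`;
  value lemmas for `add/scale/sub/mulVar/mul/combine/norm/nmul`; continuity; the two weights)

Foundation layer of the soundness theorem `WitnessRow.check = true → ForcedTsaiModulusLE M δ` (HOME
skeleton `pub-ns-dss/wall-extremal/arm-B/exact/ForcedTsaiSound_skeleton.lean`: composition proved from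
named stubs S1–S5; S5 = `…ForcedTsaiEnclosures`).  This file fixes WHAT the symbolic lists MEAN as real
functions on `ℝ³` and proves that the list operations of the checker are value-preserving, so that the
remaining stubs S1–S4 are statements of ordinary calculus about `U(y) = e^{−a|y|²}·u(y)`.
Nothing here bears on NS regularity.
-/

noncomputable section

set_option linter.dupNamespace false

namespace Summit.NavierStokesRegularity.NavierStokesRegularity.Cruxes.ScarEnvelopeTypeI.ForcedTsai

open MeasureTheory Set Metric Real
open scoped RealInnerProductSpace ContDiff
open Literature.Analysis.FluidPDE

/-! ## Definitions -/

/-- Value of a monomial at `y ∈ ℝ³`. -/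
def Mono.eval (m : Mono) (y : E3) : ℝ := (m.c : ℝ) * y 0 ^ m.e1 * y 1 ^ m.e2 * y 2 ^ m.e3

/-- Value of a sparse polynomial (the SUM of its monomials; duplicates add up). -/
def QPoly.eval (P : QPoly) (y : E3) : ℝ := (P.map fun m => Mono.eval m y).sum

/-- Value of a symbolic vector field. -/
def evalVec (V : Fin 3 → QPoly) (y : E3) : E3 := WithLp.toLp 2 fun i => QPoly.eval (V i) y

/-- The Gaussian `e^{−b|y|²}`. -/
def gauss (b : ℝ) (y : E3) : ℝ := Real.exp (-b * ‖y‖ ^ 2)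

/-- The Gaussian rate of a row as a real number, `a = s²`. -/
def WitnessRow.aR (r : WitnessRow) : ℝ := (r.s : ℝ) ^ 2

/-- **The witness field** of a row: `U(y) = e^{−a|y|²}·u(y)` with `u = curl_a p` symbolic
(`= curl (p·e^{−a|y|²})`). -/
def WitnessRow.field (r : WitnessRow) : E3 → E3 := fun y => gauss r.aR y • evalVec r.u y

/-! ## Value lemmas for the list algebra -/

/-- The empty list is `0`. -/
@[simp] theorem QPoly.eval_nil (y : E3) : QPoly.eval [] y = 0 := by simp [QPoly.eval]

/-- A cons adds the head monomial. -/
@[simp] theorem QPoly.eval_cons (m : Mono) (P : QPoly) (y : E3) :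
    QPoly.eval (m :: P) y = Mono.eval m y + QPoly.eval P y := by simp [QPoly.eval]

/-- `add` is `+`. -/
@[simp] theorem QPoly.eval_add (P Q : QPoly) (y : E3) :
    QPoly.eval (QPoly.add P Q) y = QPoly.eval P y + QPoly.eval Q y := by
  simp [QPoly.eval, QPoly.add, List.sum_append]

/-- `scale c` is `c • ·`. -/
@[simp] theorem QPoly.eval_scale (c : ℚ) (P : QPoly) (y : E3) :
    QPoly.eval (QPoly.scale c P) y = (c : ℝ) * QPoly.eval P y := by
  induction P with
  | nil => simp [QPoly.scale]
  | cons m P ih =>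
    simp only [QPoly.scale, List.map_cons, QPoly.eval_cons] at ih ⊢
    rw [ih]
    simp only [Mono.eval]
    push_cast
    ring

/-- `sub` is `−`. -/
@[simp] theorem QPoly.eval_sub (P Q : QPoly) (y : E3) :
    QPoly.eval (QPoly.sub P Q) y = QPoly.eval P y - QPoly.eval Q y := by
  simp [QPoly.sub]; ring

/-- `Mono.mulVar j` multiplies the value by `y_j`. -/
theorem Mono.eval_mulVar (j : Fin 3) (m : Mono) (y : E3) :
    Mono.eval (Mono.mulVar j m) y = y j * Mono.eval m y := by
  fin_cases j <;> simp [Mono.mulVar, Mono.eval, pow_succ] <;> ring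

/-- `mulVar j` multiplies the value by `y_j`. -/
@[simp] theorem QPoly.eval_mulVar (j : Fin 3) (P : QPoly) (y : E3) :
    QPoly.eval (QPoly.mulVar j P) y = y j * QPoly.eval P y := by
  induction P with
  | nil => simp [QPoly.mulVar]
  | cons m P ih =>
    simp only [QPoly.mulVar, List.map_cons, QPoly.eval_cons] at ih ⊢
    rw [ih, Mono.eval_mulVar]; ring

/-- `Mono.mul` multiplies values. -/
theorem Mono.eval_mul (m m' : Mono) (y : E3) :
    Mono.eval (Mono.mul m m') y = Mono.eval m y * Mono.eval m' y := by
  simp only [Mono.mul, Mono.eval, pow_add]; push_cast; ring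

/-- Mapping `Mono.mul m` over a list multiplies its value by the value of `m`. -/
theorem QPoly.eval_map_mul (m : Mono) (Q : QPoly) (y : E3) :
    QPoly.eval (Q.map (Mono.mul m)) y = Mono.eval m y * QPoly.eval Q y := by
  induction Q with
  | nil => simp
  | cons m' Q ih => simp only [List.map_cons, QPoly.eval_cons] at ih ⊢; rw [ih, Mono.eval_mul]; ring

/-- `mul` multiplies values. -/
@[simp] theorem QPoly.eval_mul (P Q : QPoly) (y : E3) :
    QPoly.eval (QPoly.mul P Q) y = QPoly.eval P y * QPoly.eval Q y := by
  induction P with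
  | nil => simp [QPoly.mul]
  | cons m P ih =>
    simp only [QPoly.mul, List.flatMap_cons] at ih ⊢
    rw [show QPoly.eval (List.map (Mono.mul m) Q ++ List.flatMap (fun m => List.map (Mono.mul m) Q) P) y =
      QPoly.eval (List.map (Mono.mul m) Q) y + QPoly.eval (List.flatMap (fun m => List.map (Mono.mul m) Q) P) y
      from by simp [QPoly.eval, List.sum_append], ih, QPoly.eval_cons, QPoly.eval_map_mul]
    ring

/-- Monomials with equal keys add their coefficients. -/
theorem Mono.eval_key_eq {m m' : Mono} (h : m.key = m'.key) (y : E3) :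
    Mono.eval { m with c := m.c + m'.c } y = Mono.eval m y + Mono.eval m' y := by
  simp only [Mono.key, Prod.mk.injEq] at h
  obtain ⟨h1, h2, h3⟩ := h
  simp only [Mono.eval, h1, h2, h3]; push_cast; ring

/-- `combine` preserves the value. -/
theorem QPoly.eval_combine (P : QPoly) (y : E3) : QPoly.eval (QPoly.combine P) y = QPoly.eval P y := by
  induction P using QPoly.combine.induct with
  | case1 => simp [QPoly.combine]
  | case2 m hc => simp [QPoly.combine, hc, Mono.eval]
  | case3 m hc => simp [QPoly.combine, hc]
  | case4 m m' rest hkey ih =>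
    rw [QPoly.combine, if_pos hkey, ih, QPoly.eval_cons, QPoly.eval_cons, QPoly.eval_cons,
      Mono.eval_key_eq hkey]
    ring
  | case5 m m' rest hkey hc ih =>
    rw [QPoly.combine, if_neg hkey, if_pos hc, ih, QPoly.eval_cons, QPoly.eval_cons]
    simp [Mono.eval, hc]
  | case6 m m' rest hkey hc ih =>
    rw [QPoly.combine, if_neg hkey, if_neg hc, QPoly.eval_cons, QPoly.eval_cons, ih, QPoly.eval_cons]

/-- A permutation of the monomial list has the same value. -/
theorem QPoly.eval_perm {P Q : QPoly} (h : P.Perm Q) (y : E3) : QPoly.eval P y = QPoly.eval Q y := by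
  unfold QPoly.eval; exact (h.map _).sum_eq

/-- `norm` preserves the value. -/
@[simp] theorem QPoly.eval_norm (P : QPoly) (y : E3) : QPoly.eval (QPoly.norm P) y = QPoly.eval P y := by
  rw [QPoly.norm, QPoly.eval_combine, QPoly.eval_perm (List.mergeSort_perm P QPoly.keyLE)]

/-- `nmul` multiplies values. -/
@[simp] theorem QPoly.eval_nmul (P Q : QPoly) (y : E3) :
    QPoly.eval (QPoly.nmul P Q) y = QPoly.eval P y * QPoly.eval Q y := by
  simp [QPoly.nmul]

/-! ## Continuity -/

/-- Monomials are continuous. -/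
theorem Mono.continuous_eval (m : Mono) : Continuous fun y : E3 => Mono.eval m y := by
  have h0 : Continuous fun y : E3 => y 0 := PiLp.continuous_apply 2 _ 0
  have h1 : Continuous fun y : E3 => y 1 := PiLp.continuous_apply 2 _ 1
  have h2 : Continuous fun y : E3 => y 2 := PiLp.continuous_apply 2 _ 2
  unfold Mono.eval
  exact ((continuous_const.mul (h0.pow _)).mul (h1.pow _)).mul (h2.pow _)

/-- Sparse polynomials are continuous. -/
theorem QPoly.continuous_eval (P : QPoly) : Continuous fun y : E3 => QPoly.eval P y := by
  induction P with
  | nil => simpa using continuous_const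
  | cons m P ih =>
    have : (fun y : E3 => QPoly.eval (m :: P) y) = fun y => Mono.eval m y + QPoly.eval P y := by
      funext y; simp
    rw [this]; exact (Mono.continuous_eval m).add ih

/-- Symbolic vector fields are continuous. -/
theorem continuous_evalVec (V : Fin 3 → QPoly) : Continuous (evalVec V) :=
  (PiLp.continuous_toLp 2 _).comp (continuous_pi fun i => QPoly.continuous_eval (V i))

/-- The Gaussian is continuous. -/
theorem continuous_gauss (b : ℝ) : Continuous (gauss b) := by
  unfold gauss; exact Real.continuous_exp.comp (continuous_const.mul (continuous_norm.pow 2))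

/-- The Gaussian is positive. -/
theorem gauss_pos (b : ℝ) (y : E3) : 0 < gauss b y := Real.exp_pos _

/-- Products of Gaussians add rates. -/
theorem gauss_mul (b b' : ℝ) (y : E3) : gauss b y * gauss b' y = gauss (b + b') y := by
  unfold gauss; rw [← Real.exp_add]; ring_nf

/-! ## The two weights and the even majorant -/

/-- Value of the level weight: `1 − |y|²/100`. -/
theorem eval_wLevel (y : E3) : QPoly.eval wLevel y = 1 - ‖y‖ ^ 2 / 100 := by
  rw [EuclideanSpace.real_norm_sq_eq, Fin.sum_univ_three]
  simp [QPoly.eval, wLevel, Mono.eval]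
  ring

/-- Value of the residual weight: `m(|y|²) = 7/2 + 35t/2 + 21t²/2 + t³/2`. -/
theorem eval_wResid (y : E3) :
    QPoly.eval wResid y = 7 / 2 + 35 / 2 * ‖y‖ ^ 2 + 21 / 2 * (‖y‖ ^ 2) ^ 2 + 1 / 2 * (‖y‖ ^ 2) ^ 3 := by
  rw [EuclideanSpace.real_norm_sq_eq, Fin.sum_univ_three]
  simp [QPoly.eval, wResid, Mono.eval]
  ring

/-- The even majorant `(1+ρ)⁵ ≤ m(ρ²)` (`m(ρ²) − (1+ρ)⁵ = (1−ρ)²(5+10ρ²+ρ⁴)/2`). -/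
theorem pow_five_le_m (ρ : ℝ) :
    (1 + ρ) ^ 5 ≤ 7 / 2 + 35 / 2 * ρ ^ 2 + 21 / 2 * (ρ ^ 2) ^ 2 + 1 / 2 * (ρ ^ 2) ^ 3 := by
  nlinarith [sq_nonneg (1 - ρ), sq_nonneg ρ, sq_nonneg (ρ ^ 2), mul_nonneg (sq_nonneg (1 - ρ)) (sq_nonneg ρ),
    mul_nonneg (sq_nonneg (1 - ρ)) (sq_nonneg (ρ ^ 2))]

/-- The value of the constant-one polynomial. -/
theorem eval_one (y : E3) : QPoly.eval [⟨0, 0, 0, 1⟩] y = 1 := by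
  simp [QPoly.eval, Mono.eval]

end Summit.NavierStokesRegularity.NavierStokesRegularity.Cruxes.ScarEnvelopeTypeI.ForcedTsai

end
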